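import Summits.QuantumFields.BalabanUV.Beta.WardLocusCubic

/-!
# `BalabanUV.Beta.WardLocusInductionBorder` — binder row D1, hW class: THE BLOCK-STENCIL WARD LAW PROPAGATED THROUGH A RECURSIVE FAMILY, RESOLVENT-
# AND BORDER-GENERIC (`WardLocusInduction.hSd_step` ∕ `hSd_all` with the comb border table `vhSAt ρ` ABSTRACTED to any first-order table `Vb`)

HONEST FRAMING (cell charter, verbatim): «discharging BetaPertH makes Balaban's UV stability UNCONDITIONAL — a real constructive-QFT result; it is
NOT the continuum limit and NOT the Clay problem.»  HONEST DEPENDENCY: continuum YM on T⁴ ⇐ BetaPertH ∧ nine spine estimates (0/9 proved);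
BetaPertH ⇐ (D1) ∧ (D4) ∧ CAP+tail; G-an2-4 gates asym, D1 and NE2/3/4.
DERIVED cell leaf (β sub-cell, BINDER-OWNERS row D1 OWNER `b2b-balaban-beta-an2`, gen 27; the generic engine of the (Sd)-letter route for the (0.4) literal
`JsB12Sym` located in X-an2-55 — serves ANY of its three repairs, because the border table is a parameter).  No statement of Bałaban's papers, no `[cite:]`,
no `Prop` fact, no `def`.  Discharges NO binder; proves NO letter of any literal: it is an2-g16∕leaf-10's induction engine (`WardLocusInduction` §2–§3,
an2 gen 16 + the slot files' (hT) shape `RecursiveStencilSlot.divV_SrecOf_succ`) with ONE symbol abstracted — the first-order BORDER table `Vb` whose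
divergence appears both in the recursion's border sector (hT) and in the step-Hessian dictionary (hM′); the proofs are the originals VERBATIM.  For the
comb (`Vb := vhSAt ρ`) it re-proves nothing new; for `JsB12Sym` (`Vb := tabs.V`) it is the engine whose remaining inputs are EXACTLY X-an2-55's: the
level-0 law (h0), the projector commutation (hEX) (`SymSliceProjectorDiagComm`), and the dictionary (hM′) for the chosen spread.  NOT D1, NOT `BetaPertH`,
NOT continuum, NOT Clay.
WHAT ([folklore]): **`hSd_step_border`** — one level up: level-j data (K, M, E, RelInv, ℋ-column law hH, generator localised + E-commuting, the block
stencil Ward law hSd of S w.r.t. M), next-level shape (hT) `divV T u = a • divV (e3K K Lc S) u + b • divV Vb u` and (hM′) `conjV M′ (diagK (legInd ρ u)) =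
w • conjV (mmRead Lc K) (diagK (legInd ρ u)) − P • divV Vb u`, scalar locks ⟹ the law for T w.r.t. M′.  **`hSd_all_border`** — all levels by induction
(families K j, M j, S j, one E, one border table Vb, constants cH ξ a b w P, level-0 law h0).
Provenance: β sub-cell, unit beta-an2 gen 27, 2026-08-21 (v1); over `WardLocusCubic.divV_e3K_eq_conjV` (an2 gen 16), `WardLocusS0N` BY NAME; `WardLocusInduction`'s
two theorems are the instances `Vb := vhSAt (toSite r) d Lc`; no existing file touched.
-/

noncomputable section

open Finset
open scoped BigOperators
open Literature.MathematicalPhysics.QuantumFieldTheory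
open Literature.MathematicalPhysics.QuantumFieldTheory.Balaban1983to89
open Literature.MathematicalPhysics.QuantumFieldTheory.Balaban1983to89.Beta
open ExpKernelCalculus (MKer Decays comp)
open OneStepResolventKernel (Fib LocStencil)
open OneStepKernelFamily (colH)
open KernelWard (divV)
open AffineAveraging (box toSite)
open BalabanStepJetsSucc (mmRead)
open Summit.QuantumFields.BalabanUV.Beta.TameKernelCalculus
open Summit.QuantumFields.BalabanUV.Beta.ChartConjugation (conjV)
open Summit.QuantumFields.BalabanUV.Beta.ChartConjugationRelative (RelInv)
open Summit.QuantumFields.BalabanUV.Beta.BorderedHessian (diagK)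
open Summit.QuantumFields.BalabanUV.Beta.AveragingWardRootedStencils (legInd)
open Summit.QuantumFields.BalabanUV.Beta.KernelWardRelative (gaugeWt)
open Summit.QuantumFields.BalabanUV.Beta.WardLocusS0N (conjV_diagK_smul conjV_diagK_sum)
open Summit.QuantumFields.BalabanUV.Beta.WardLocusCubic (e3K divV_e3K_eq_conjV)

namespace Summit.QuantumFields.BalabanUV.Beta.WardLocusInductionBorder

variable {d : ℕ}

/-! ## §1 The induction step, resolvent- and border-generic -/

section Step

variable {Lc : ℕ}

/-- [folklore] **THE BLOCK STENCIL WARD LAW PROPAGATES ONE LEVEL UP** (resolvent-generic AND border-generic: `WardLocusInduction.hSd_step` with the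
border table `vhSAt ρ` replaced by an arbitrary first-order table `Vb` in (hT) and (hM′); proof verbatim). -/
theorem hSd_step_border (hLc : 1 ≤ Lc) {r : Fin (d + 1) → ℕ} (hr : r ∈ box (d + 1) Lc) {K M E : MKer (d + 1) (Fib d)}
    (hKd : ∃ δ C : ℝ, 0 < δ ∧ 0 ≤ C ∧ Decays K C δ) (hM : Spr M) (hE : Spr E) (hR : RelInv K M E)
    {S : Fin (d + 1) → (Fin (d + 1) → ℤ) → MKer (d + 1) (Fib d)} {Cs δs : ℝ} (hS : LocStencil S Cs δs) (hδs : 0 < δs) {cH ξ : ℝ}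
    (hH : ∀ (y : Fin (d + 1) → ℤ) (κ' : Fin (d + 1)) (u : Fin (d + 1) → ℤ),
      ∑ μ, (colH K Lc μ (y - B6BondElimination.unitVec μ) κ' u - colH K Lc μ y κ' u) = cH * gaugeWt Lc y κ' u)
    (hX : ∀ y : Fin (d + 1) → ℤ, Loc (diagK (ξ • ∑ v ∈ box (d + 1) Lc, legInd (toSite r) ((Lc : ℤ) • y + toSite v))))
    (hEX : ∀ y : Fin (d + 1) → ℤ, comp E (diagK (ξ • ∑ v ∈ box (d + 1) Lc, legInd (toSite r) ((Lc : ℤ) • y + toSite v))) =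
      comp (diagK (ξ • ∑ v ∈ box (d + 1) Lc, legInd (toSite r) ((Lc : ℤ) • y + toSite v))) E)
    (hSd : ∀ y : Fin (d + 1) → ℤ, cH • ∑ v ∈ box (d + 1) Lc, divV S ((Lc : ℤ) • y + toSite v) =
      conjV M (diagK (ξ • ∑ v ∈ box (d + 1) Lc, legInd (toSite r) ((Lc : ℤ) • y + toSite v))))
    {T : Fin (d + 1) → (Fin (d + 1) → ℤ) → MKer (d + 1) (Fib d)} {Vb : Fin (d + 1) → (Fin (d + 1) → ℤ) → MKer (d + 1) (Fib d)} {a b : ℝ}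
    (hT : ∀ u : Fin (d + 1) → ℤ, divV T u = a • divV (e3K K Lc S) u + b • divV Vb u)
    {M' : MKer (d + 1) (Fib d)} {w P : ℝ}
    (hM' : ∀ u : Fin (d + 1) → ℤ, conjV M' (diagK (legInd (toSite r) u)) =
      w • conjV (mmRead Lc K) (diagK (legInd (toSite r) u)) - P • divV Vb u)
    {cH' ξ' : ℝ} (h₁ : cH' * a * ξ = ξ' * w) (h₂ : cH' * b = -(ξ' * P)) (y : Fin (d + 1) → ℤ) :
    cH' • ∑ v ∈ box (d + 1) Lc, divV T ((Lc : ℤ) • y + toSite v) =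
      conjV M' (diagK (ξ' • ∑ v ∈ box (d + 1) Lc, legInd (toSite r) ((Lc : ℤ) • y + toSite v))) := by
  -- the cubic Ward law at this level (`WardLocusCubic.divV_e3K_eq_conjV`)
  have hc : ∀ u : Fin (d + 1) → ℤ, divV (e3K K Lc S) u = ξ • conjV (mmRead Lc K) (diagK (legInd (toSite r) u)) := fun u =>
    divV_e3K_eq_conjV hKd hM hE hR hLc hS hδs hr cH ξ hH hX hEX hSd (toSite r) u
  have key : ∀ u : Fin (d + 1) → ℤ, cH' • divV T u = ξ' • conjV M' (diagK (legInd (toSite r) u)) := by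
    intro u
    calc cH' • divV T u
        = (cH' * a * ξ) • conjV (mmRead Lc K) (diagK (legInd (toSite r) u)) + (cH' * b) • divV Vb u := by
          rw [hT u, hc u, smul_add, smul_smul, smul_smul, smul_smul]
      _ = (ξ' * w) • conjV (mmRead Lc K) (diagK (legInd (toSite r) u)) + (-(ξ' * P)) • divV Vb u := by rw [h₁, h₂]
      _ = ξ' • conjV M' (diagK (legInd (toSite r) u)) := by
          rw [hM' u, smul_sub, smul_smul, smul_smul, neg_smul, sub_eq_add_neg]
  rw [Finset.smul_sum, conjV_diagK_smul, conjV_diagK_sum, Finset.smul_sum]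
  exact Finset.sum_congr rfl fun v _ => key _

end Step

/-! ## §2 All levels by induction -/

section All

variable {Lc : ℕ}

/-- [folklore] **THE BLOCK STENCIL WARD LAW AT EVERY LEVEL, BY INDUCTION** (resolvent- and border-generic; `WardLocusInduction.hSd_all` with
`vhSAt ρ ↦ Vb`).  Inputs per level: (hKd)(hM)(hR) with one projector `E` (hE), the ℋ-column law (hH), the generator's localisation (hX) and
`E`-commutation (hEX); the recursive tie (hT) with border table `Vb`; the step-Hessian dictionary (hM′) with the SAME `Vb`; scalar locks (h₁)(h₂);
the level-0 law (h0). -/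
theorem hSd_all_border (hLc : 1 ≤ Lc) {r : Fin (d + 1) → ℕ} (hr : r ∈ box (d + 1) Lc) {K M : ℕ → MKer (d + 1) (Fib d)} {E : MKer (d + 1) (Fib d)}
    (hKd : ∀ j, ∃ δ C : ℝ, 0 < δ ∧ 0 ≤ C ∧ Decays (K j) C δ) (hM : ∀ j, Spr (M j)) (hE : Spr E) (hR : ∀ j, RelInv (K j) (M j) E)
    {S : ℕ → Fin (d + 1) → (Fin (d + 1) → ℤ) → MKer (d + 1) (Fib d)} {Cs δs : ℕ → ℝ} (hS : ∀ j, LocStencil (S j) (Cs j) (δs j))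
    (hδs : ∀ j, 0 < δs j) {cH ξ : ℕ → ℝ}
    (hH : ∀ (j : ℕ) (y : Fin (d + 1) → ℤ) (κ' : Fin (d + 1)) (u : Fin (d + 1) → ℤ),
      ∑ μ, (colH (K j) Lc μ (y - B6BondElimination.unitVec μ) κ' u - colH (K j) Lc μ y κ' u) = cH j * gaugeWt Lc y κ' u)
    (hX : ∀ (j : ℕ) (y : Fin (d + 1) → ℤ), Loc (diagK (ξ j • ∑ v ∈ box (d + 1) Lc, legInd (toSite r) ((Lc : ℤ) • y + toSite v))))
    (hEX : ∀ (j : ℕ) (y : Fin (d + 1) → ℤ), comp E (diagK (ξ j • ∑ v ∈ box (d + 1) Lc, legInd (toSite r) ((Lc : ℤ) • y + toSite v))) =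
      comp (diagK (ξ j • ∑ v ∈ box (d + 1) Lc, legInd (toSite r) ((Lc : ℤ) • y + toSite v))) E)
    {Vb : Fin (d + 1) → (Fin (d + 1) → ℤ) → MKer (d + 1) (Fib d)} {a b w P : ℕ → ℝ}
    (hT : ∀ (j : ℕ) (u : Fin (d + 1) → ℤ), divV (S (j + 1)) u = a (j + 1) • divV (e3K (K j) Lc (S j)) u + b (j + 1) • divV Vb u)
    (hM' : ∀ (j : ℕ) (u : Fin (d + 1) → ℤ), conjV (M (j + 1)) (diagK (legInd (toSite r) u)) =
      w (j + 1) • conjV (mmRead Lc (K j)) (diagK (legInd (toSite r) u)) - P (j + 1) • divV Vb u)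
    (h₁ : ∀ j, cH (j + 1) * a (j + 1) * ξ j = ξ (j + 1) * w (j + 1)) (h₂ : ∀ j, cH (j + 1) * b (j + 1) = -(ξ (j + 1) * P (j + 1)))
    (h0 : ∀ y : Fin (d + 1) → ℤ, cH 0 • ∑ v ∈ box (d + 1) Lc, divV (S 0) ((Lc : ℤ) • y + toSite v) =
      conjV (M 0) (diagK (ξ 0 • ∑ v ∈ box (d + 1) Lc, legInd (toSite r) ((Lc : ℤ) • y + toSite v)))) :
    ∀ (j : ℕ) (y : Fin (d + 1) → ℤ), cH j • ∑ v ∈ box (d + 1) Lc, divV (S j) ((Lc : ℤ) • y + toSite v) =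
      conjV (M j) (diagK (ξ j • ∑ v ∈ box (d + 1) Lc, legInd (toSite r) ((Lc : ℤ) • y + toSite v))) := by
  intro j
  induction j with
  | zero => exact h0
  | succ j ih =>
    intro y
    exact hSd_step_border hLc hr (hKd j) (hM j) hE (hR j) (hS j) (hδs j) (hH j) (hX j) (hEX j) ih (hT j) (hM' j) (h₁ j) (h₂ j) y

end All

end Summit.QuantumFields.BalabanUV.Beta.WardLocusInductionBorder

end
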